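import Literature.MathematicalPhysics.QuantumFieldTheory.VortexTwistCohomology
import Literature.MathematicalPhysics.QuantumLattice.LatticeGaugeDLRGibbsProofs
import Literature.MathematicalPhysics.QuantumFieldTheory.LatticeGaugeShenZhuZhuProofs
import HarnessLib

/-!
# Venture YMGap — the coupling-sign symmetry `β ↔ -β` of `SU(2)` lattice Yang–Mills on `ℤ^d`
# (staggered centre flip): kernels, DLR states and uniqueness

HONEST FRAMING: venture file (cell `pub-ymgap`, track (c) «DS», red-team brick of ds-3), strong-coupling
LATTICE bookkeeping about the tree's infinite-volume Wilson specification
`ymSpecification (fundamentalRep (Fin 2)) β` on `ℤ^d`; nothing about the continuum, confinement or the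
Clay mass gap, and no coupling window is asserted.  PURPOSE: the track-(c) rows (DLR uniqueness,
`MassGapAt 4 2 β`, …) are proved for `0 ≤ β` only, whereas the track-(a) target type `ImprovedThreshold` /
`MassGapBelow` of `StrongCouplingGapShape.lean` is two-sided (`|β| < β₀`, as in Shen–Zhu–Zhu).  For `SU(2)`
the two signs are equivalent by the classical change of variables
`U(x, μ) ↦ (-𝟙)^{x_0 + ⋯ + x_{μ-1}} U(x, μ)` (Kogut–Susskind staggered phase carried by the centre element
`-𝟙`, tree `Tomboulis2007.negOne`): a Haar-preserving measurable involution multiplying EVERY plaquette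
holonomy by `-𝟙`, so `S_Λ ∘ flip = 4·#P_Λ - S_Λ` and the DLR kernels at `β` and `-β` are intertwined.  (On a
torus the same map needs an even side, cf. `Tomboulis2007.oddStaircase`; on `ℤ^d` there is no obstruction.)

* `flip`, `flipEquiv`; `plaquetteHolonomyZd_flip : U_p(flip U) = -𝟙 · U_p(U)` (`i ≠ j`);
  `wilsonBoundaryAction_flip : S_Λ(flip U) = 4·#(plaquettesTouching Λ) - S_Λ(U)`;
* `integral_ymSpecification_flip`, `ymSpecification_neg_eq_map` — `γ^{-β}_Λ(·|η) = γ^{β}_Λ(·|flip η)∘flip⁻¹`;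
* `isGibbsMeasure_map_flip` (`μ ∈ 𝒢(β) ⇒ μ∘flip⁻¹ ∈ 𝒢(-β)`), `hasUniqueGibbsMeasure_neg(_iff)`.
Sibling file `CouplingSignFlipMassGap.lean`: `MassGapAt d 2 β → MassGapAt d 2 (-β)` and the two-sided rows.

References: J. Kogut, L. Susskind, Phys. Rev. D 11 (1975) 395 (staggered phases); E. Tomboulis,
arXiv:0707.2179 §4 (centre flips; tree `VortexTwistCohomology.lean`); H.-O. Georgii, Gibbs Measures and
Phase Transitions (2011) §5.1 (symmetries of specifications act on `𝒢(γ)`).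
-/
noncomputable section

open MeasureTheory ProbabilityTheory Finset Function
open Literature.Probability.LatticeModels
open Literature.MathematicalPhysics.QuantumLattice
open Literature.MathematicalPhysics.QuantumFieldTheory (haarProbability
  isSpecification_ymSpecification_of_t2Space)
open Literature.MathematicalPhysics.QuantumFieldTheory.Tomboulis2007 (SU2 negOne negOne_mul_negOne
  negOne_mul_comm)

namespace Summit.Ventures.YMGap.SignFlip

variable {d : ℕ}

/-! ### Centre signs -/

/-- The centre sign `(-𝟙)^n ∈ SU(2)` of an integer `n` (only its parity matters). [folklore] -/
def sgn (n : ℤ) : SU2 := if Even n then 1 else negOne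

/-- `(-𝟙)^n = 𝟙` for even `n`. [folklore] -/
theorem sgn_of_even {n : ℤ} (h : Even n) : sgn n = 1 := if_pos h

/-- `(-𝟙)^n = -𝟙` for odd `n`. [folklore] -/
theorem sgn_of_odd {n : ℤ} (h : Odd n) : sgn n = negOne := if_neg (Int.not_even_iff_odd.2 h)

/-- `(-𝟙)^{m+n} = (-𝟙)^m (-𝟙)^n`. [folklore] -/
theorem sgn_add (m n : ℤ) : sgn (m + n) = sgn m * sgn n := by
  rcases Int.even_or_odd m with hm | hm <;> rcases Int.even_or_odd n with hn | hn
  · rw [sgn_of_even hm, sgn_of_even hn, sgn_of_even (hm.add hn), one_mul]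
  · rw [sgn_of_even hm, sgn_of_odd hn, sgn_of_odd (hm.add_odd hn), one_mul]
  · rw [sgn_of_odd hm, sgn_of_even hn, sgn_of_odd (hm.add_even hn), mul_one]
  · rw [sgn_of_odd hm, sgn_of_odd hn, sgn_of_even (hm.add_odd hn), negOne_mul_negOne]

/-- Each centre sign is an involution. [folklore] -/
theorem sgn_mul_self (n : ℤ) : sgn n * sgn n = 1 := by
  rw [← sgn_add, sgn_of_even ⟨n, rfl⟩]

/-- Each centre sign is central. [folklore] -/
theorem sgn_comm (n : ℤ) (U : SU2) : sgn n * U = U * sgn n := by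
  unfold sgn
  split_ifs
  · rw [one_mul, mul_one]
  · exact negOne_mul_comm U

/-- `((-𝟙)^n)⁻¹ = (-𝟙)^n`. [folklore] -/
theorem sgn_inv (n : ℤ) : (sgn n)⁻¹ = sgn n :=
  inv_eq_of_mul_eq_one_right (sgn_mul_self n)

/-- `((-𝟙)^n U)⁻¹ = (-𝟙)^n U⁻¹`. [folklore] -/
theorem sgn_mul_inv (n : ℤ) (U : SU2) : (sgn n * U)⁻¹ = sgn n * U⁻¹ := by
  rw [mul_inv_rev, sgn_inv, sgn_comm]

/-- The underlying matrix of `(-𝟙)^n U` is `± U`. [folklore] -/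
theorem coe_sgn_mul (n : ℤ) (U : SU2) :
    ((sgn n * U : SU2) : Matrix (Fin 2) (Fin 2) ℂ) =
      if Even n then (U : Matrix (Fin 2) (Fin 2) ℂ) else -(U : Matrix (Fin 2) (Fin 2) ℂ) := by
  unfold sgn
  split_ifs
  · rw [one_mul]
  · rw [Submonoid.coe_mul]
    show (-1 : Matrix (Fin 2) (Fin 2) ℂ) * _ = _
    rw [neg_one_mul]

/-! ### The staggered phase and the flip -/

/-- The Kogut–Susskind staggered count `x_0 + ⋯ + x_{μ-1}` of the link `(x, μ)` of `ℤ^d`. [folklore] -/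
def ksPhase (e : ZdEdge d) : ℤ := ∑ ν ∈ univ.filter (fun ν : Fin d => ν < e.2), e.1 ν

/-- The centre sign `(-𝟙)^{x_0 + ⋯ + x_{μ-1}}` carried by the link `(x, μ)`. [folklore] -/
def linkSign (e : ZdEdge d) : SU2 := sgn (ksPhase e)

/-- **The staggered centre flip** `U(x, μ) ↦ (-𝟙)^{x_0 + ⋯ + x_{μ-1}} U(x, μ)` of an `SU(2)` lattice
gauge field on `ℤ^d`. [folklore] -/
def flip (U : LGConfig d SU2) : LGConfig d SU2 := fun e => linkSign e * U e

/-- `flip` unfolded. [folklore] -/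
theorem flip_apply (U : LGConfig d SU2) (e : ZdEdge d) : flip U e = linkSign e * U e := rfl

/-- Each link sign is an involution. [folklore] -/
theorem linkSign_mul_self (e : ZdEdge d) : linkSign e * linkSign e = 1 := sgn_mul_self _

/-- The flip is an involution. [folklore] -/
theorem flip_flip (U : LGConfig d SU2) : flip (flip U) = U := by
  funext e
  rw [flip_apply, flip_apply, ← mul_assoc, linkSign_mul_self, one_mul]

/-- The flip is an involution. [folklore] -/
theorem flip_involutive : Function.Involutive (flip (d := d)) := flip_flip

/-- The flip is measurable (coordinatewise left translation). [folklore] -/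
theorem measurable_flip : Measurable (flip (d := d)) := by
  refine measurable_pi_iff.2 fun e => ?_
  exact (continuous_const.mul continuous_id).measurable.comp (measurable_pi_apply e)

/-- The flip as a measurable involution of the configuration space. [folklore] -/
def flipEquiv : LGConfig d SU2 ≃ᵐ LGConfig d SU2 where
  toFun := flip
  invFun := flip
  left_inv := flip_flip
  right_inv := flip_flip
  measurable_toFun := measurable_flip
  measurable_invFun := measurable_flip

/-- The underlying map of `flipEquiv` is `flip`. [folklore] -/
@[simp] theorem coe_flipEquiv : ⇑(flipEquiv (d := d)) = flip := rfl

/-! ### Every plaquette holonomy flips sign -/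

/-- The staggered count across a unit step: `ks(x + eᵢ, μ) = ks(x, μ) + [i < μ]`. [folklore] -/
theorem ksPhase_add_single (x : Site d) (i μ : Fin d) :
    ksPhase (x + Pi.single i 1, μ) = ksPhase (x, μ) + if i < μ then 1 else 0 := by
  simp only [ksPhase, Pi.add_apply, sum_add_distrib, Pi.single_apply, sum_ite_eq', mem_filter,
    mem_univ, true_and]

/-- **Kogut–Susskind parity**: around the plaquette at `x` in the `(i, j)` plane, `i ≠ j`, the four
link signs multiply to `-𝟙`. [folklore] -/
theorem linkSign_prod_plaquette (x : Site d) {i j : Fin d} (hij : i ≠ j) :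
    linkSign (x, i) * linkSign (x + Pi.single i 1, j) * linkSign (x + Pi.single j 1, i) *
      linkSign (x, j) = negOne := by
  simp only [linkSign, ksPhase_add_single, ← sgn_add]
  apply sgn_of_odd
  rcases lt_or_gt_of_ne hij with h | h
  · rw [if_pos h, if_neg (not_lt.2 h.le)]
    exact ⟨ksPhase (x, i) + ksPhase (x, j), by ring⟩
  · rw [if_neg (not_lt.2 h.le), if_pos h]
    exact ⟨ksPhase (x, i) + ksPhase (x, j), by ring⟩

/-- **The flipped holonomy**: `U_p(flip U) = -𝟙 · U_p(U)` for every genuine plaquette (`i ≠ j`). [folklore] -/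
theorem plaquetteHolonomyZd_flip (U : LGConfig d SU2) (x : Site d) {i j : Fin d} (hij : i ≠ j) :
    plaquetteHolonomyZd (flip U) x i j = negOne * plaquetteHolonomyZd U x i j := by
  rw [← linkSign_prod_plaquette x hij]
  simp only [plaquetteHolonomyZd, flip_apply, linkSign, sgn_mul_inv]
  set s₁ := sgn (ksPhase (x, i))
  set s₂ := sgn (ksPhase (x + Pi.single i 1, j))
  set s₃ := sgn (ksPhase (x + Pi.single j 1, i))
  set s₄ := sgn (ksPhase (x, j))
  have h₂ : ∀ V : SU2, s₂ * V = V * s₂ := sgn_comm _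
  have h₃ : ∀ V : SU2, s₃ * V = V * s₃ := sgn_comm _
  have h₄ : ∀ V : SU2, s₄ * V = V * s₄ := sgn_comm _
  calc s₁ * U (x, i) * (s₂ * U (x + Pi.single i 1, j)) * (s₃ * (U (x + Pi.single j 1, i))⁻¹) *
        (s₄ * (U (x, j))⁻¹)
      = s₁ * (U (x, i) * s₂) * U (x + Pi.single i 1, j) * s₃ * (U (x + Pi.single j 1, i))⁻¹ * s₄ *
          (U (x, j))⁻¹ := by simp only [mul_assoc]
    _ = s₁ * (s₂ * U (x, i)) * U (x + Pi.single i 1, j) * s₃ * (U (x + Pi.single j 1, i))⁻¹ * s₄ *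
          (U (x, j))⁻¹ := by rw [h₂]
    _ = s₁ * s₂ * (U (x, i) * U (x + Pi.single i 1, j) * s₃) * (U (x + Pi.single j 1, i))⁻¹ * s₄ *
          (U (x, j))⁻¹ := by simp only [mul_assoc]
    _ = s₁ * s₂ * (s₃ * (U (x, i) * U (x + Pi.single i 1, j))) * (U (x + Pi.single j 1, i))⁻¹ * s₄ *
          (U (x, j))⁻¹ := by rw [h₃]
    _ = s₁ * s₂ * s₃ * (U (x, i) * U (x + Pi.single i 1, j) * (U (x + Pi.single j 1, i))⁻¹ * s₄) *
          (U (x, j))⁻¹ := by simp only [mul_assoc]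
    _ = s₁ * s₂ * s₃ * (s₄ * (U (x, i) * U (x + Pi.single i 1, j) * (U (x + Pi.single j 1, i))⁻¹)) *
          (U (x, j))⁻¹ := by rw [h₄]
    _ = s₁ * s₂ * s₃ * s₄ * (U (x, i) * U (x + Pi.single i 1, j) * (U (x + Pi.single j 1, i))⁻¹ *
          (U (x, j))⁻¹) := by simp only [mul_assoc]

/-- **The plaquette observable flips sign**: `Re tr U_p(flip U) = -Re tr U_p(U)` (`i ≠ j`). [folklore] -/
theorem plaquetteObs_flip (U : LGConfig d SU2) (x : Site d) {i j : Fin d} (hij : i ≠ j) :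
    plaquetteObs (fundamentalRep (Fin 2)) x i j (flip U) =
      -plaquetteObs (fundamentalRep (Fin 2)) x i j U := by
  simp only [plaquetteObs, plaquetteHolonomyZd_flip U x hij, fundamentalRep_apply, Submonoid.coe_mul]
  show ((-1 : Matrix (Fin 2) (Fin 2) ℂ) * _).trace.re = _
  rw [neg_one_mul, Matrix.trace_neg, Complex.neg_re]

/-- **The Wilson boundary action flips**: `S_Λ(flip U) = 4·#P_Λ - S_Λ(U)`, `P_Λ` the plaquettes
touching `Λ` (each term `2 - Re tr U_p` becomes `2 + Re tr U_p`). [folklore] -/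
theorem wilsonBoundaryAction_flip (Λ : Finset (ZdEdge d)) (U : LGConfig d SU2) :
    wilsonBoundaryAction (fundamentalRep (Fin 2)) Λ (flip U) =
      4 * (plaquettesTouching Λ).card - wilsonBoundaryAction (fundamentalRep (Fin 2)) Λ U := by
  simp only [wilsonBoundaryAction]
  rw [show (4 : ℝ) * ((plaquettesTouching Λ).card : ℝ) = ∑ p ∈ plaquettesTouching Λ, (4 : ℝ) by
      rw [sum_const, nsmul_eq_mul, mul_comm], ← sum_sub_distrib]
  refine sum_congr rfl fun p _ => ?_
  rw [plaquetteObs_flip U p.1 (ne_of_lt p.2.2)]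
  push_cast
  ring

/-! ### The kernel identity `γ^{-β}_Λ(· | η) = γ^{β}_Λ(· | flip η) ∘ flip⁻¹` -/

section Kernel

variable (Λ : Finset (ZdEdge d))

/-- The flip restricted to the links of `Λ`. [folklore] -/
def flipIn (ζ : ↥Λ → SU2) : ↥Λ → SU2 := fun e => linkSign (e : ZdEdge d) * ζ e

/-- `flipIn` is an involution. [folklore] -/
theorem flipIn_flipIn (ζ : ↥Λ → SU2) : flipIn Λ (flipIn Λ ζ) = ζ := by
  funext e
  show linkSign (e : ZdEdge d) * (linkSign (e : ZdEdge d) * ζ e) = ζ e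
  rw [← mul_assoc, linkSign_mul_self, one_mul]

/-- `flipIn` is measurable. [folklore] -/
theorem measurable_flipIn : Measurable (flipIn (d := d) Λ) := by
  refine measurable_pi_iff.2 fun e => ?_
  exact (continuous_const.mul continuous_id).measurable.comp (measurable_pi_apply e)

/-- `flipIn` as a measurable involution. [folklore] -/
def flipInEquiv : (↥Λ → SU2) ≃ᵐ (↥Λ → SU2) where
  toFun := flipIn Λ
  invFun := flipIn Λ
  left_inv := flipIn_flipIn Λ
  right_inv := flipIn_flipIn Λ
  measurable_toFun := measurable_flipIn Λ
  measurable_invFun := measurable_flipIn Λ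

/-- **Gluing intertwines the flips**: flipping the glued field `ζ (flip η)_{Λᶜ}` gives the field glued
from the flipped interior `flipIn ζ` and the exterior `η`. [folklore] -/
theorem flip_glueWith_flip (ζ : ↥Λ → SU2) (η : LGConfig d SU2) :
    flip (glueWith Λ ζ (flip η)) = glueWith Λ (flipIn Λ ζ) η := by
  funext e
  by_cases he : e ∈ Λ
  · rw [flip_apply, glueWith_apply_mem _ _ _ he, glueWith_apply_mem _ _ _ he]
    rfl
  · rw [flip_apply, glueWith_apply_not_mem _ _ _ he, glueWith_apply_not_mem _ _ _ he, flip_apply,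
      ← mul_assoc, linkSign_mul_self, one_mul]

/-- The same identity read backwards. [folklore] -/
theorem glueWith_flip_eq (ζ : ↥Λ → SU2) (η : LGConfig d SU2) :
    glueWith Λ ζ (flip η) = flip (glueWith Λ (flipIn Λ ζ) η) := by
  rw [← flip_glueWith_flip, flip_flip]

/-- **`flipIn` preserves the product Haar measure** (link by link a left translation by a centre
element; Mathlib `measurePreserving_pi`). [folklore] -/
theorem measurePreserving_flipIn :
    MeasurePreserving (flipIn Λ) (Measure.pi fun _ : ↥Λ => haarProbability SU2)
      (Measure.pi fun _ : ↥Λ => haarProbability SU2) :=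
  measurePreserving_pi (f := fun (e : ↥Λ) (g : SU2) => linkSign (e : ZdEdge d) * g)
    (fun _ : ↥Λ => haarProbability SU2) (fun _ : ↥Λ => haarProbability SU2)
    fun e => measurePreserving_mul_left (haarProbability SU2) (linkSign (e : ZdEdge d))

/-- Change of variables under `flipIn` in a product-Haar integral. [folklore] -/
theorem integral_comp_flipIn (G : (↥Λ → SU2) → ℝ) :
    ∫ ζ, G (flipIn Λ ζ) ∂(Measure.pi fun _ : ↥Λ => haarProbability SU2) =
      ∫ ζ, G ζ ∂(Measure.pi fun _ : ↥Λ => haarProbability SU2) :=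
  (measurePreserving_flipIn Λ).integral_comp (flipInEquiv Λ).measurableEmbedding G

/-- **The kernel identity, integral form**: for measurable `F`,
`∫ F dγ^{-β}_Λ(· | η) = ∫ F ∘ flip dγ^{β}_Λ(· | flip η)`.  Both sides are ratios of product-Haar
integrals (`integral_ymSpecification`); after `flip ∘ glue = glue ∘ flipIn` and
`S_Λ ∘ flip = 4#P_Λ - S_Λ` the constant `e^{-4β #P_Λ}` cancels and `flipIn` is a Haar-preserving change
of variables. [folklore] -/
theorem integral_ymSpecification_flip (β : ℝ) (η : LGConfig d SU2) {F : LGConfig d SU2 → ℝ}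
    (hF : Measurable F) :
    ∫ U, F U ∂(ymSpecification (d := d) (fundamentalRep (Fin 2)) (-β) Λ η) =
      ∫ U, F (flip U) ∂(ymSpecification (d := d) (fundamentalRep (Fin 2)) β Λ (flip η)) := by
  haveI : SecondCountableTopology (Matrix (Fin 2) (Fin 2) ℂ) :=
    inferInstanceAs (SecondCountableTopology (Fin 2 → Fin 2 → ℂ))
  haveI : SecondCountableTopology SU2 := Topology.IsEmbedding.subtypeVal.secondCountableTopology
  have hρ := continuous_fundamentalRep (Fin 2)
  rw [integral_ymSpecification (fundamentalRep (Fin 2)) hρ (-β) Λ hF η,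
    show (∫ U, F (flip U) ∂(ymSpecification (d := d) (fundamentalRep (Fin 2)) β Λ (flip η))) =
      ∫ U, (F ∘ flip) U ∂(ymSpecification (d := d) (fundamentalRep (Fin 2)) β Λ (flip η)) from rfl,
    integral_ymSpecification (fundamentalRep (Fin 2)) hρ β Λ (hF.comp measurable_flip) (flip η)]
  set S := wilsonBoundaryAction (d := d) (fundamentalRep (Fin 2)) Λ with hS
  set c : ℝ := Real.exp (-β * (4 * ((plaquettesTouching Λ).card : ℝ))) with hc
  have hnum : (fun ζ : ↥Λ → SU2 => (F ∘ flip) (glueWith Λ ζ (flip η)) *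
        Real.exp (-β * S (glueWith Λ ζ (flip η)))) =
      fun ζ => c * (F (glueWith Λ (flipIn Λ ζ) η) *
        Real.exp (-(-β) * S (glueWith Λ (flipIn Λ ζ) η))) := by
    funext ζ
    rw [Function.comp_apply, glueWith_flip_eq, flip_flip, hS, wilsonBoundaryAction_flip,
      show -β * (4 * ((plaquettesTouching Λ).card : ℝ) -
          wilsonBoundaryAction (fundamentalRep (Fin 2)) Λ (glueWith Λ (flipIn Λ ζ) η)) =
        -β * (4 * ((plaquettesTouching Λ).card : ℝ)) +
          -(-β) * wilsonBoundaryAction (fundamentalRep (Fin 2)) Λ (glueWith Λ (flipIn Λ ζ) η) by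
        ring, Real.exp_add, hc]
    ring
  have hden : (fun ζ : ↥Λ → SU2 => Real.exp (-β * S (glueWith Λ ζ (flip η)))) =
      fun ζ => c * Real.exp (-(-β) * S (glueWith Λ (flipIn Λ ζ) η)) := by
    funext ζ
    rw [glueWith_flip_eq, hS, wilsonBoundaryAction_flip,
      show -β * (4 * ((plaquettesTouching Λ).card : ℝ) -
          wilsonBoundaryAction (fundamentalRep (Fin 2)) Λ (glueWith Λ (flipIn Λ ζ) η)) =
        -β * (4 * ((plaquettesTouching Λ).card : ℝ)) +
          -(-β) * wilsonBoundaryAction (fundamentalRep (Fin 2)) Λ (glueWith Λ (flipIn Λ ζ) η) by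
        ring, Real.exp_add, hc]
  rw [hnum, hden, integral_const_mul, integral_const_mul,
    integral_comp_flipIn Λ (fun ζ => F (glueWith Λ ζ η) * Real.exp (-(-β) * S (glueWith Λ ζ η))),
    integral_comp_flipIn Λ (fun ζ => Real.exp (-(-β) * S (glueWith Λ ζ η))),
    mul_div_mul_left _ _ (Real.exp_pos _).ne']

/-- **The kernel identity, measure form**: `γ^{-β}_Λ(· | η) = γ^{β}_Λ(· | flip η) ∘ flip⁻¹`. [folklore] -/
theorem ymSpecification_neg_eq_map (β : ℝ) (η : LGConfig d SU2) :
    ymSpecification (d := d) (fundamentalRep (Fin 2)) (-β) Λ η =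
      (ymSpecification (d := d) (fundamentalRep (Fin 2)) β Λ (flip η)).map flip := by
  haveI : SecondCountableTopology (Matrix (Fin 2) (Fin 2) ℂ) :=
    inferInstanceAs (SecondCountableTopology (Fin 2 → Fin 2 → ℂ))
  haveI : SecondCountableTopology SU2 := Topology.IsEmbedding.subtypeVal.secondCountableTopology
  have hρ := continuous_fundamentalRep (Fin 2)
  haveI : IsProbabilityMeasure (ymSpecification (d := d) (fundamentalRep (Fin 2)) (-β) Λ η) :=
    isProbabilityMeasure_ymSpecification _ hρ _ _ _
  haveI : IsProbabilityMeasure (ymSpecification (d := d) (fundamentalRep (Fin 2)) β Λ (flip η)) :=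
    isProbabilityMeasure_ymSpecification _ hρ _ _ _
  haveI : IsProbabilityMeasure
      ((ymSpecification (d := d) (fundamentalRep (Fin 2)) β Λ (flip η)).map flip) :=
    Measure.isProbabilityMeasure_map measurable_flip.aemeasurable
  ext A hA
  have h : (ymSpecification (d := d) (fundamentalRep (Fin 2)) (-β) Λ η).real A =
      ((ymSpecification (d := d) (fundamentalRep (Fin 2)) β Λ (flip η)).map flip).real A := by
    rw [measureReal_def, measureReal_def, Measure.map_apply measurable_flip hA,
      ← measureReal_def, ← measureReal_def, ← integral_indicator_one hA,
      ← integral_indicator_one (measurable_flip hA)]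
    have hind : (flip ⁻¹' A).indicator (1 : LGConfig d SU2 → ℝ) =
        (A.indicator (1 : LGConfig d SU2 → ℝ)) ∘ flip := by
      funext U
      by_cases hU : flip U ∈ A
      · simp [Set.indicator, hU]
      · simp [Set.indicator, hU]
    rw [hind]
    exact integral_ymSpecification_flip Λ β η (measurable_one.indicator hA)
  rw [measureReal_def, measureReal_def] at h
  exact (ENNReal.toReal_eq_toReal_iff' (measure_ne_top _ _) (measure_ne_top _ _)).1 h

/-- The kernel identity on events: `γ^{-β}_Λ(A | flip η) = γ^{β}_Λ(flip⁻¹ A | η)`. [folklore] -/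
theorem ymSpecification_neg_apply (β : ℝ) (η : LGConfig d SU2) {A : Set (LGConfig d SU2)}
    (hA : MeasurableSet A) :
    ymSpecification (d := d) (fundamentalRep (Fin 2)) (-β) Λ (flip η) A =
      ymSpecification (d := d) (fundamentalRep (Fin 2)) β Λ η (flip ⁻¹' A) := by
  rw [ymSpecification_neg_eq_map, Measure.map_apply measurable_flip hA, flip_flip]

end Kernel

/-! ### DLR states and uniqueness transport -/

/-- The flip is an involution on measures. [folklore] -/
theorem map_flip_map_flip (μ : Measure (LGConfig d SU2)) : (μ.map flip).map flip = μ := by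
  rw [Measure.map_map measurable_flip measurable_flip, flip_involutive.comp_self, Measure.map_id]

/-- **`𝒢(β) ∘ flip⁻¹ ⊆ 𝒢(-β)`**: the image of a DLR state at coupling `β` under the flip is a DLR
state at coupling `-β` (Georgii 2011 §5.1: a symmetry intertwining two specifications maps Gibbs
measures to Gibbs measures). [folklore] -/
theorem isGibbsMeasure_map_flip {β : ℝ} {μ : Measure (LGConfig d SU2)}
    (hμ : IsGibbsMeasure (ymSpecification (d := d) (fundamentalRep (Fin 2)) β) μ) :
    IsGibbsMeasure (ymSpecification (d := d) (fundamentalRep (Fin 2)) (-β)) (μ.map flip) := by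
  haveI : SecondCountableTopology (Matrix (Fin 2) (Fin 2) ℂ) :=
    inferInstanceAs (SecondCountableTopology (Fin 2 → Fin 2 → ℂ))
  haveI : SecondCountableTopology SU2 := Topology.IsEmbedding.subtypeVal.secondCountableTopology
  haveI := hμ.isProbabilityMeasure
  refine ⟨Measure.isProbabilityMeasure_map measurable_flip.aemeasurable, fun Λ A hA => ?_⟩
  have hγ : IsSpecification (ymSpecification (d := d) (fundamentalRep (Fin 2)) (-β)) :=
    isSpecification_ymSpecification_of_t2Space _ (continuous_fundamentalRep (Fin 2)) _
  rw [lintegral_map (hγ.measurable_coe Λ hA) measurable_flip, Measure.map_apply measurable_flip hA,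
    ← hμ.2 Λ _ (measurable_flip hA)]
  refine lintegral_congr fun η => ?_
  exact ymSpecification_neg_apply Λ β η hA

/-- **DLR uniqueness is symmetric in the sign of the coupling** (`SU(2)`, any `d`). [folklore] -/
theorem hasUniqueGibbsMeasure_neg {β : ℝ}
    (h : HasUniqueGibbsMeasure (ymSpecification (d := d) (fundamentalRep (Fin 2)) β)) :
    HasUniqueGibbsMeasure (ymSpecification (d := d) (fundamentalRep (Fin 2)) (-β)) := by
  obtain ⟨hsub, μ, hμ⟩ := h
  refine ⟨fun ν₁ hν₁ ν₂ hν₂ => ?_, ⟨μ.map flip, isGibbsMeasure_map_flip hμ⟩⟩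
  have h₁ := isGibbsMeasure_map_flip (d := d) hν₁
  have h₂ := isGibbsMeasure_map_flip (d := d) hν₂
  rw [neg_neg] at h₁ h₂
  rw [← map_flip_map_flip ν₁, hsub h₁ h₂, map_flip_map_flip]

/-- Iff form. [folklore] -/
theorem hasUniqueGibbsMeasure_neg_iff (β : ℝ) :
    HasUniqueGibbsMeasure (ymSpecification (d := d) (fundamentalRep (Fin 2)) (-β)) ↔
      HasUniqueGibbsMeasure (ymSpecification (d := d) (fundamentalRep (Fin 2)) β) :=
  ⟨fun h => by simpa using hasUniqueGibbsMeasure_neg (d := d) h, hasUniqueGibbsMeasure_neg⟩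

end Summit.Ventures.YMGap.SignFlip

end
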